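import Literature.Computability.Cryptography.HallgrenClassGroupXgcdFP
import Literature.Computability.Complexity.CodeFPArith
import Literature.NumberTheory.CubicFields.PureCubicLatticeCodes
import HarnessLib

/-!
# The programs on codes of a pure cubic field are typed polynomial time (`CodeFP`)

Topic `Computability/Cryptography`; theorem-only companion of
`NumberTheory/CubicFields/PureCubicLatticeCodes.lean` (the programs `mulE`, `normE`, `latScale`,
`latProd`, `latAddGen` and their parts `lin2`, `xrow`, `ins`, `reduce`, `hnf`, `tgcd`, `codeOf`,
`rowsOf`, `mulRow`, `normRow`). Every program is a fixed composition of integer arithmetic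
(`CodeFPArith.lean`: `intAdd`, `intMul`, `intEDiv`, …), the extended gcd `intGcdABC` of
`HallgrenClassGroupXgcdFP.lean`, projections and list constructors; the Hermite normal form of a
FIXED number of rows is unrolled (`hnfListC`), so no loop bound is needed: typed polynomial time
is closed under composition (`CodeFP.comp`, `CodeFP.pair`, `CodeFP.ite`).

* `lin2C`, `xrowC`, `insC`, `negIfC`, `reduceC`, `foldInsC`, `hnfListC`, `tgcdC`, `codeOfC`,
  `rowsOfC`, `rowOfEC`, `mulRowC`, `normRowC`, `scaleRowC`; **`mulEC`, `normEC`, `latScaleC`,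
  `latProdC`, `latAddGenC`** on the codes `pairE natE natE` (context `(a, b)`),
  `pairE intE (pairE intE (pairE intE natE))` (elements), `pairE natE (rawE intE)` (lattices).
  Every composite is elaborated bottom-up (`exact (… :)`), never against the expected map.

## References

* S. Arora, B. Barak, *Computational Complexity: A Modern Approach*, CUP 2009, §1.3
  (polynomial time is closed under composition). [AroraBarak2009]
* H. Cohen, *A Course in Computational Algebraic Number Theory*, GTM 138, 1993, Algorithm 2.4.5,
  §4.7.1. [Cohen1993]
-/

namespace Literature.Computability.Cryptography

namespace PureCubicFP

open Literature.Computability.Complexity Literature.Computability.Complexity.CodeFP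
  Literature.NumberTheory.CubicFields.PureCubicCodes Hallgren2005.ClFP

-- codes: rows `ℤ × ℤ × ℤ` by `pairE intE (pairE intE intE)`, triples of rows by its triple `pairE`, elements
-- `ℤ × ℤ × ℤ × ℕ` by `pairE intE (pairE intE (pairE intE natE))`, lattices `ℕ × List ℤ` by `pairE natE (rawE intE)`

variable {σ : Type} {eσ : σ → List Bool}

/-! ### Rows -/

/-- `lin2` is computed on codes. [cite: AroraBarak2009, §1.3] -/
theorem lin2C : CodeFP (pairE (pairE intE intE) (pairE (pairE intE (pairE intE intE)) (pairE intE (pairE intE intE)))) (pairE intE (pairE intE intE)) (fun p => lin2 p.1.1 p.1.2 p.2.1 p.2.2) := by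
  have hs : CodeFP (pairE (pairE intE intE) (pairE (pairE intE (pairE intE intE)) (pairE intE (pairE intE intE)))) intE (fun p => p.1.1) := (fst _ _).fst'
  have ht : CodeFP (pairE (pairE intE intE) (pairE (pairE intE (pairE intE intE)) (pairE intE (pairE intE intE)))) intE (fun p => p.1.2) := (fst _ _).snd'
  have p1 : CodeFP (pairE (pairE intE intE) (pairE (pairE intE (pairE intE intE)) (pairE intE (pairE intE intE)))) intE (fun p => p.2.1.1) := (snd _ _).fst'.fst'
  have p2 : CodeFP (pairE (pairE intE intE) (pairE (pairE intE (pairE intE intE)) (pairE intE (pairE intE intE)))) intE (fun p => p.2.1.2.1) := (snd _ _).fst'.snd'.fst'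
  have p3 : CodeFP (pairE (pairE intE intE) (pairE (pairE intE (pairE intE intE)) (pairE intE (pairE intE intE)))) intE (fun p => p.2.1.2.2) := (snd _ _).fst'.snd'.snd'
  have v1 : CodeFP (pairE (pairE intE intE) (pairE (pairE intE (pairE intE intE)) (pairE intE (pairE intE intE)))) intE (fun p => p.2.2.1) := (snd _ _).snd'.fst'
  have v2 : CodeFP (pairE (pairE intE intE) (pairE (pairE intE (pairE intE intE)) (pairE intE (pairE intE intE)))) intE (fun p => p.2.2.2.1) := (snd _ _).snd'.snd'.fst'
  have v3 : CodeFP (pairE (pairE intE intE) (pairE (pairE intE (pairE intE intE)) (pairE intE (pairE intE intE)))) intE (fun p => p.2.2.2.2) := (snd _ _).snd'.snd'.snd'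
  have c1 : CodeFP (pairE (pairE intE intE) (pairE (pairE intE (pairE intE intE)) (pairE intE (pairE intE intE)))) intE (fun p => p.1.1 * p.2.1.1 + p.1.2 * p.2.2.1) := by
    exact (intAdd.comp ((intMul.comp (hs.pair p1)).pair (intMul.comp (ht.pair v1))) :)
  have c2 : CodeFP (pairE (pairE intE intE) (pairE (pairE intE (pairE intE intE)) (pairE intE (pairE intE intE)))) intE (fun p => p.1.1 * p.2.1.2.1 + p.1.2 * p.2.2.2.1) := by
    exact (intAdd.comp ((intMul.comp (hs.pair p2)).pair (intMul.comp (ht.pair v2))) :)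
  have c3 : CodeFP (pairE (pairE intE intE) (pairE (pairE intE (pairE intE intE)) (pairE intE (pairE intE intE)))) intE (fun p => p.1.1 * p.2.1.2.2 + p.1.2 * p.2.2.2.2) := by
    exact (intAdd.comp ((intMul.comp (hs.pair p3)).pair (intMul.comp (ht.pair v3))) :)
  exact (c1.pair (c2.pair c3) :)

/-- `xrow` is computed on codes (test `vk = 0`, else `intGcdABC` and two `lin2`). [cite: AroraBarak2009, §1.3] -/
theorem xrowC : CodeFP (pairE (pairE intE intE) (pairE (pairE intE (pairE intE intE)) (pairE intE (pairE intE intE)))) (pairE (pairE intE (pairE intE intE)) (pairE intE (pairE intE intE)))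
    (fun p => xrow p.1.1 p.1.2 p.2.1 p.2.2) := by
  have hpk : CodeFP (pairE (pairE intE intE) (pairE (pairE intE (pairE intE intE)) (pairE intE (pairE intE intE)))) intE (fun p => p.1.1) := (fst _ _).fst'
  have hvk : CodeFP (pairE (pairE intE intE) (pairE (pairE intE (pairE intE intE)) (pairE intE (pairE intE intE)))) intE (fun p => p.1.2) := (fst _ _).snd'
  have hpv : CodeFP (pairE (pairE intE intE) (pairE (pairE intE (pairE intE intE)) (pairE intE (pairE intE intE)))) (pairE (pairE intE (pairE intE intE)) (pairE intE (pairE intE intE))) (fun p => p.2) := snd _ _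
  have hG : CodeFP (pairE (pairE intE intE) (pairE (pairE intE (pairE intE intE)) (pairE intE (pairE intE intE)))) (pairE natE (pairE intE intE))
      (fun p => (Int.gcd p.1.1 p.1.2, Int.gcdA p.1.1 p.1.2, Int.gcdB p.1.1 p.1.2)) := by
    exact (intGcdABC.comp (hpk.pair hvk) :)
  have hg : CodeFP (pairE (pairE intE intE) (pairE (pairE intE (pairE intE intE)) (pairE intE (pairE intE intE)))) intE (fun p => ((Int.gcd p.1.1 p.1.2 : ℕ) : ℤ)) := by
    exact (intOfNat.comp hG.fst' :)
  have h1 : CodeFP (pairE (pairE intE intE) (pairE (pairE intE (pairE intE intE)) (pairE intE (pairE intE intE)))) (pairE intE (pairE intE intE))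
      (fun p => lin2 (Int.gcdA p.1.1 p.1.2) (Int.gcdB p.1.1 p.1.2) p.2.1 p.2.2) := by
    exact (lin2C.comp ((hG.snd'.fst'.pair hG.snd'.snd').pair hpv) :)
  have h2 : CodeFP (pairE (pairE intE intE) (pairE (pairE intE (pairE intE intE)) (pairE intE (pairE intE intE)))) (pairE intE (pairE intE intE))
      (fun p => lin2 (-(p.1.2 / Int.gcd p.1.1 p.1.2)) (p.1.1 / Int.gcd p.1.1 p.1.2) p.2.1 p.2.2) := by
    exact (lin2C.comp (((intNeg.comp (intEDiv.comp (hvk.pair hg))).pair (intEDiv.comp (hpk.pair hg))).pair hpv) :)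
  have htest : CodeFP (pairE (pairE intE intE) (pairE (pairE intE (pairE intE intE)) (pairE intE (pairE intE intE)))) bitE (fun p => decide (p.1.2 = 0)) := by
    exact (intEq.comp (hvk.pair (const _ 0)) :)
  have fin : CodeFP (pairE (pairE intE intE) (pairE (pairE intE (pairE intE intE)) (pairE intE (pairE intE intE)))) (pairE (pairE intE (pairE intE intE)) (pairE intE (pairE intE intE)))
      (fun p => if decide (p.1.2 = 0) then p.2 else
        (lin2 (Int.gcdA p.1.1 p.1.2) (Int.gcdB p.1.1 p.1.2) p.2.1 p.2.2,
          lin2 (-(p.1.2 / Int.gcd p.1.1 p.1.2)) (p.1.1 / Int.gcd p.1.1 p.1.2) p.2.1 p.2.2)) := by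
    exact (ite htest hpv (h1.pair h2) :)
  refine fin.congr fun p => ?_
  by_cases h : p.1.2 = 0
  · simp [xrow, h]
  · simp [xrow, h]

/-- `ins` is computed on codes (three `xrow`). [cite: AroraBarak2009, §1.3] -/
theorem insC : CodeFP (pairE (pairE (pairE intE (pairE intE intE)) (pairE (pairE intE (pairE intE intE)) (pairE intE (pairE intE intE)))) (pairE intE (pairE intE intE))) (pairE (pairE intE (pairE intE intE)) (pairE (pairE intE (pairE intE intE)) (pairE intE (pairE intE intE)))) (fun p => ins p.1 p.2) := by
  have s1 : CodeFP (pairE (pairE (pairE intE (pairE intE intE)) (pairE (pairE intE (pairE intE intE)) (pairE intE (pairE intE intE)))) (pairE intE (pairE intE intE))) (pairE intE (pairE intE intE)) (fun p => p.1.1) := (fst _ _).fst'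
  have s2 : CodeFP (pairE (pairE (pairE intE (pairE intE intE)) (pairE (pairE intE (pairE intE intE)) (pairE intE (pairE intE intE)))) (pairE intE (pairE intE intE))) (pairE intE (pairE intE intE)) (fun p => p.1.2.1) := (fst _ _).snd'.fst'
  have s3 : CodeFP (pairE (pairE (pairE intE (pairE intE intE)) (pairE (pairE intE (pairE intE intE)) (pairE intE (pairE intE intE)))) (pairE intE (pairE intE intE))) (pairE intE (pairE intE intE)) (fun p => p.1.2.2) := (fst _ _).snd'.snd'
  have hv : CodeFP (pairE (pairE (pairE intE (pairE intE intE)) (pairE (pairE intE (pairE intE intE)) (pairE intE (pairE intE intE)))) (pairE intE (pairE intE intE))) (pairE intE (pairE intE intE)) (fun p => p.2) := snd _ _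
  have E1 : CodeFP (pairE (pairE (pairE intE (pairE intE intE)) (pairE (pairE intE (pairE intE intE)) (pairE intE (pairE intE intE)))) (pairE intE (pairE intE intE))) (pairE (pairE intE (pairE intE intE)) (pairE intE (pairE intE intE))) (fun p => xrow p.1.1.1 p.2.1 p.1.1 p.2) := by
    exact (xrowC.comp ((s1.fst'.pair hv.fst').pair (s1.pair hv)) :)
  have E2 : CodeFP (pairE (pairE (pairE intE (pairE intE intE)) (pairE (pairE intE (pairE intE intE)) (pairE intE (pairE intE intE)))) (pairE intE (pairE intE intE))) (pairE (pairE intE (pairE intE intE)) (pairE intE (pairE intE intE)))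
      (fun p => xrow p.1.2.1.2.1 (xrow p.1.1.1 p.2.1 p.1.1 p.2).2.2.1 p.1.2.1 (xrow p.1.1.1 p.2.1 p.1.1 p.2).2) := by
    exact (xrowC.comp ((s2.snd'.fst'.pair E1.snd'.snd'.fst').pair (s2.pair E1.snd')) :)
  have E3 : CodeFP (pairE (pairE (pairE intE (pairE intE intE)) (pairE (pairE intE (pairE intE intE)) (pairE intE (pairE intE intE)))) (pairE intE (pairE intE intE))) (pairE (pairE intE (pairE intE intE)) (pairE intE (pairE intE intE)))
      (fun p => xrow p.1.2.2.2.2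
        (xrow p.1.2.1.2.1 (xrow p.1.1.1 p.2.1 p.1.1 p.2).2.2.1 p.1.2.1 (xrow p.1.1.1 p.2.1 p.1.1 p.2).2).2.2.2 p.1.2.2
        (xrow p.1.2.1.2.1 (xrow p.1.1.1 p.2.1 p.1.1 p.2).2.2.1 p.1.2.1 (xrow p.1.1.1 p.2.1 p.1.1 p.2).2).2) := by
    exact (xrowC.comp ((s3.snd'.snd'.pair E2.snd'.snd'.snd').pair (s3.pair E2.snd')) :)
  exact (E1.fst'.pair (E2.fst'.pair E3.fst') :)

/-- `negIf` is computed on codes. [cite: AroraBarak2009, §1.3] -/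
theorem negIfC : CodeFP (pairE intE (pairE intE (pairE intE intE))) (pairE intE (pairE intE intE)) (fun p => negIf p.1 p.2) := by
  have hc : CodeFP (pairE intE (pairE intE (pairE intE intE))) intE (fun p => p.1) := fst _ _
  have hp : CodeFP (pairE intE (pairE intE (pairE intE intE))) (pairE intE (pairE intE intE)) (fun p => p.2) := snd _ _
  have hneg : CodeFP (pairE intE (pairE intE (pairE intE intE))) (pairE intE (pairE intE intE)) (fun p => (-p.2.1, -p.2.2.1, -p.2.2.2)) := by
    exact ((intNeg.comp hp.fst').pair ((intNeg.comp hp.snd'.fst').pair (intNeg.comp hp.snd'.snd')) :)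
  have htest : CodeFP (pairE intE (pairE intE (pairE intE intE))) bitE (fun p => decide (p.1 < 0)) := by
    exact (intLt.comp (hc.pair (const _ 0)) :)
  have fin : CodeFP (pairE intE (pairE intE (pairE intE intE))) (pairE intE (pairE intE intE)) (fun p => if decide (p.1 < 0) then (-p.2.1, -p.2.2.1, -p.2.2.2) else p.2) := by
    exact (ite htest hneg hp :)
  refine fin.congr fun p => ?_
  by_cases h : p.1 < 0
  · simp [negIf, h]
  · simp [negIf, h]

/-- `reduce` is computed on codes. [cite: AroraBarak2009, §1.3] -/
theorem reduceC : CodeFP (pairE (pairE intE (pairE intE intE)) (pairE (pairE intE (pairE intE intE)) (pairE intE (pairE intE intE)))) (pairE (pairE intE (pairE intE intE)) (pairE (pairE intE (pairE intE intE)) (pairE intE (pairE intE intE)))) reduce := by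
  have r1 : CodeFP (pairE (pairE intE (pairE intE intE)) (pairE (pairE intE (pairE intE intE)) (pairE intE (pairE intE intE)))) (pairE intE (pairE intE intE)) (fun s => negIf s.1.1 s.1) := by exact (negIfC.comp ((fst _ _).fst'.pair (fst _ _)) :)
  have r2 : CodeFP (pairE (pairE intE (pairE intE intE)) (pairE (pairE intE (pairE intE intE)) (pairE intE (pairE intE intE)))) (pairE intE (pairE intE intE)) (fun s => negIf s.2.1.2.1 s.2.1) := by
    exact (negIfC.comp ((snd _ _).fst'.snd'.fst'.pair (snd _ _).fst') :)
  have r3 : CodeFP (pairE (pairE intE (pairE intE intE)) (pairE (pairE intE (pairE intE intE)) (pairE intE (pairE intE intE)))) (pairE intE (pairE intE intE)) (fun s => negIf s.2.2.2.2 s.2.2) := by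
    exact (negIfC.comp ((snd _ _).snd'.snd'.snd'.pair (snd _ _).snd') :)
  have one : CodeFP (pairE (pairE intE (pairE intE intE)) (pairE (pairE intE (pairE intE intE)) (pairE intE (pairE intE intE)))) intE (fun _ => (1 : ℤ)) := const _ 1
  have r1' : CodeFP (pairE (pairE intE (pairE intE intE)) (pairE (pairE intE (pairE intE intE)) (pairE intE (pairE intE intE)))) (pairE intE (pairE intE intE)) (fun s => lin2 1 (-((negIf s.1.1 s.1).2.1 / (negIf s.2.1.2.1 s.2.1).2.1))
      (negIf s.1.1 s.1) (negIf s.2.1.2.1 s.2.1)) := by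
    exact (lin2C.comp ((one.pair (intNeg.comp (intEDiv.comp (r1.snd'.fst'.pair r2.snd'.fst')))).pair (r1.pair r2)) :)
  have r1'' : CodeFP (pairE (pairE intE (pairE intE intE)) (pairE (pairE intE (pairE intE intE)) (pairE intE (pairE intE intE)))) (pairE intE (pairE intE intE)) (fun s => lin2 1
      (-((lin2 1 (-((negIf s.1.1 s.1).2.1 / (negIf s.2.1.2.1 s.2.1).2.1)) (negIf s.1.1 s.1) (negIf s.2.1.2.1 s.2.1)).2.2 /
        (negIf s.2.2.2.2 s.2.2).2.2))
      (lin2 1 (-((negIf s.1.1 s.1).2.1 / (negIf s.2.1.2.1 s.2.1).2.1)) (negIf s.1.1 s.1) (negIf s.2.1.2.1 s.2.1))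
      (negIf s.2.2.2.2 s.2.2)) := by
    exact (lin2C.comp ((one.pair (intNeg.comp (intEDiv.comp (r1'.snd'.snd'.pair r3.snd'.snd')))).pair (r1'.pair r3)) :)
  have r2' : CodeFP (pairE (pairE intE (pairE intE intE)) (pairE (pairE intE (pairE intE intE)) (pairE intE (pairE intE intE)))) (pairE intE (pairE intE intE)) (fun s => lin2 1 (-((negIf s.2.1.2.1 s.2.1).2.2 / (negIf s.2.2.2.2 s.2.2).2.2))
      (negIf s.2.1.2.1 s.2.1) (negIf s.2.2.2.2 s.2.2)) := by
    exact (lin2C.comp ((one.pair (intNeg.comp (intEDiv.comp (r2.snd'.snd'.pair r3.snd'.snd')))).pair (r2.pair r3)) :)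
  exact (r1''.pair (r2'.pair r3) :)

/-- Inserting a fixed list of computed rows into a computed triple is computed on codes (unrolled
composition, no loop bound). [cite: AroraBarak2009, §1.3] -/
theorem foldInsC {st : σ → Rows} (hst : CodeFP eσ (pairE (pairE intE (pairE intE intE)) (pairE (pairE intE (pairE intE intE)) (pairE intE (pairE intE intE)))) st) :
    ∀ fs : List (σ → Row), (∀ f ∈ fs, CodeFP eσ (pairE intE (pairE intE intE)) f) →
      CodeFP eσ (pairE (pairE intE (pairE intE intE)) (pairE (pairE intE (pairE intE intE)) (pairE intE (pairE intE intE)))) (fun x => (fs.map fun f => f x).foldl ins (st x))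
  | [], _ => by exact (hst :)
  | f :: fs, hfs => by
    have hf : CodeFP eσ (pairE intE (pairE intE intE)) f := hfs f (by simp)
    have hst' : CodeFP eσ (pairE (pairE intE (pairE intE intE)) (pairE (pairE intE (pairE intE intE)) (pairE intE (pairE intE intE)))) (fun x => ins (st x) (f x)) := by exact (insC.comp (hst.pair hf) :)
    have h : CodeFP eσ (pairE (pairE intE (pairE intE intE)) (pairE (pairE intE (pairE intE intE)) (pairE intE (pairE intE intE)))) (fun x => (fs.map fun f => f x).foldl ins (ins (st x) (f x))) :=
      foldInsC hst' fs (fun g hg => hfs g (List.mem_cons_of_mem _ hg))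
    exact (h :)

/-- **The HNF of a fixed list of computed rows is computed on codes.** [cite: AroraBarak2009, §1.3] -/
theorem hnfListC (fs : List (σ → Row)) (hfs : ∀ f ∈ fs, CodeFP eσ (pairE intE (pairE intE intE)) f) :
    CodeFP eσ (pairE (pairE intE (pairE intE intE)) (pairE (pairE intE (pairE intE intE)) (pairE intE (pairE intE intE)))) (fun x => hnf (fs.map fun f => f x)) := by
  have h0 : CodeFP eσ (pairE (pairE intE (pairE intE intE)) (pairE (pairE intE (pairE intE intE)) (pairE intE (pairE intE intE)))) (fun _ => (((0, 0, 0), (0, 0, 0), (0, 0, 0)) : Rows)) := const _ _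
  have h := foldInsC h0 fs hfs
  exact (reduceC.comp h :)

/-- `tgcd` is computed on codes (six nested `intGcdABC`). [cite: AroraBarak2009, §1.3] -/
theorem tgcdC : CodeFP (pairE natE (pairE (pairE intE (pairE intE intE)) (pairE (pairE intE (pairE intE intE)) (pairE intE (pairE intE intE))))) natE (fun p => tgcd p.1 p.2) := by
  have hD : CodeFP (pairE natE (pairE (pairE intE (pairE intE intE)) (pairE (pairE intE (pairE intE intE)) (pairE intE (pairE intE intE))))) intE (fun p => (p.1 : ℤ)) := by exact (intOfNat.comp (fst _ _) :)
  have s11 : CodeFP (pairE natE (pairE (pairE intE (pairE intE intE)) (pairE (pairE intE (pairE intE intE)) (pairE intE (pairE intE intE))))) intE (fun p => p.2.1.1) := (snd _ _).fst'.fst'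
  have s12 : CodeFP (pairE natE (pairE (pairE intE (pairE intE intE)) (pairE (pairE intE (pairE intE intE)) (pairE intE (pairE intE intE))))) intE (fun p => p.2.1.2.1) := (snd _ _).fst'.snd'.fst'
  have s13 : CodeFP (pairE natE (pairE (pairE intE (pairE intE intE)) (pairE (pairE intE (pairE intE intE)) (pairE intE (pairE intE intE))))) intE (fun p => p.2.1.2.2) := (snd _ _).fst'.snd'.snd'
  have s22 : CodeFP (pairE natE (pairE (pairE intE (pairE intE intE)) (pairE (pairE intE (pairE intE intE)) (pairE intE (pairE intE intE))))) intE (fun p => p.2.2.1.2.1) := (snd _ _).snd'.fst'.snd'.fst'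
  have s23 : CodeFP (pairE natE (pairE (pairE intE (pairE intE intE)) (pairE (pairE intE (pairE intE intE)) (pairE intE (pairE intE intE))))) intE (fun p => p.2.2.1.2.2) := (snd _ _).snd'.fst'.snd'.snd'
  have s33 : CodeFP (pairE natE (pairE (pairE intE (pairE intE intE)) (pairE (pairE intE (pairE intE intE)) (pairE intE (pairE intE intE))))) intE (fun p => p.2.2.2.2.2) := (snd _ _).snd'.snd'.snd'.snd'
  have g5 : CodeFP (pairE natE (pairE (pairE intE (pairE intE intE)) (pairE (pairE intE (pairE intE intE)) (pairE intE (pairE intE intE))))) natE (fun p => Int.gcd p.2.2.1.2.2 p.2.2.2.2.2) := by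
    exact ((intGcdABC.comp (s23.pair s33)).fst' :)
  have g4 : CodeFP (pairE natE (pairE (pairE intE (pairE intE intE)) (pairE (pairE intE (pairE intE intE)) (pairE intE (pairE intE intE))))) natE (fun p => Int.gcd p.2.2.1.2.1 (Int.gcd p.2.2.1.2.2 p.2.2.2.2.2)) := by
    exact ((intGcdABC.comp (s22.pair (intOfNat.comp g5))).fst' :)
  have g3 : CodeFP (pairE natE (pairE (pairE intE (pairE intE intE)) (pairE (pairE intE (pairE intE intE)) (pairE intE (pairE intE intE))))) natE
      (fun p => Int.gcd p.2.1.2.2 (Int.gcd p.2.2.1.2.1 (Int.gcd p.2.2.1.2.2 p.2.2.2.2.2))) := by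
    exact ((intGcdABC.comp (s13.pair (intOfNat.comp g4))).fst' :)
  have g2 : CodeFP (pairE natE (pairE (pairE intE (pairE intE intE)) (pairE (pairE intE (pairE intE intE)) (pairE intE (pairE intE intE))))) natE
      (fun p => Int.gcd p.2.1.2.1 (Int.gcd p.2.1.2.2 (Int.gcd p.2.2.1.2.1 (Int.gcd p.2.2.1.2.2 p.2.2.2.2.2)))) := by
    exact ((intGcdABC.comp (s12.pair (intOfNat.comp g3))).fst' :)
  have g1 : CodeFP (pairE natE (pairE (pairE intE (pairE intE intE)) (pairE (pairE intE (pairE intE intE)) (pairE intE (pairE intE intE))))) natE (fun p => Int.gcd p.2.1.1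
      (Int.gcd p.2.1.2.1 (Int.gcd p.2.1.2.2 (Int.gcd p.2.2.1.2.1 (Int.gcd p.2.2.1.2.2 p.2.2.2.2.2))))) := by
    exact ((intGcdABC.comp (s11.pair (intOfNat.comp g2))).fst' :)
  exact ((intGcdABC.comp (hD.pair (intOfNat.comp g1))).fst' :)

/-- `codeOf` is computed on codes. [cite: AroraBarak2009, §1.3] -/
theorem codeOfC : CodeFP (pairE natE (pairE (pairE intE (pairE intE intE)) (pairE (pairE intE (pairE intE intE)) (pairE intE (pairE intE intE))))) (pairE natE (rawE intE)) (fun p => codeOf p.1 p.2) := by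
  have hg : CodeFP (pairE natE (pairE (pairE intE (pairE intE intE)) (pairE (pairE intE (pairE intE intE)) (pairE intE (pairE intE intE))))) natE (fun p => tgcd p.1 p.2) := tgcdC
  have hgz : CodeFP (pairE natE (pairE (pairE intE (pairE intE intE)) (pairE (pairE intE (pairE intE intE)) (pairE intE (pairE intE intE))))) intE (fun p => ((tgcd p.1 p.2 : ℕ) : ℤ)) := by exact (intOfNat.comp hg :)
  have hD : CodeFP (pairE natE (pairE (pairE intE (pairE intE intE)) (pairE (pairE intE (pairE intE intE)) (pairE intE (pairE intE intE))))) natE (fun p => p.1 / tgcd p.1 p.2) := by exact (natDiv.comp ((fst _ _).pair hg) :)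
  have s11 : CodeFP (pairE natE (pairE (pairE intE (pairE intE intE)) (pairE (pairE intE (pairE intE intE)) (pairE intE (pairE intE intE))))) intE (fun p => p.2.1.1 / tgcd p.1 p.2) := by
    exact (intEDiv.comp ((snd _ _).fst'.fst'.pair hgz) :)
  have s12 : CodeFP (pairE natE (pairE (pairE intE (pairE intE intE)) (pairE (pairE intE (pairE intE intE)) (pairE intE (pairE intE intE))))) intE (fun p => p.2.1.2.1 / tgcd p.1 p.2) := by
    exact (intEDiv.comp ((snd _ _).fst'.snd'.fst'.pair hgz) :)
  have s13 : CodeFP (pairE natE (pairE (pairE intE (pairE intE intE)) (pairE (pairE intE (pairE intE intE)) (pairE intE (pairE intE intE))))) intE (fun p => p.2.1.2.2 / tgcd p.1 p.2) := by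
    exact (intEDiv.comp ((snd _ _).fst'.snd'.snd'.pair hgz) :)
  have s22 : CodeFP (pairE natE (pairE (pairE intE (pairE intE intE)) (pairE (pairE intE (pairE intE intE)) (pairE intE (pairE intE intE))))) intE (fun p => p.2.2.1.2.1 / tgcd p.1 p.2) := by
    exact (intEDiv.comp ((snd _ _).snd'.fst'.snd'.fst'.pair hgz) :)
  have s23 : CodeFP (pairE natE (pairE (pairE intE (pairE intE intE)) (pairE (pairE intE (pairE intE intE)) (pairE intE (pairE intE intE))))) intE (fun p => p.2.2.1.2.2 / tgcd p.1 p.2) := by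
    exact (intEDiv.comp ((snd _ _).snd'.fst'.snd'.snd'.pair hgz) :)
  have s33 : CodeFP (pairE natE (pairE (pairE intE (pairE intE intE)) (pairE (pairE intE (pairE intE intE)) (pairE intE (pairE intE intE))))) intE (fun p => p.2.2.2.2.2 / tgcd p.1 p.2) := by
    exact (intEDiv.comp ((snd _ _).snd'.snd'.snd'.snd'.pair hgz) :)
  have nil : CodeFP (pairE natE (pairE (pairE intE (pairE intE intE)) (pairE (pairE intE (pairE intE intE)) (pairE intE (pairE intE intE))))) (rawE intE) (fun _ => ([] : List ℤ)) := const _ _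
  have l6 := ((rawCons intE).comp (s33.pair nil) :)
  have l5 := ((rawCons intE).comp (s23.pair l6) :)
  have l4 := ((rawCons intE).comp (s22.pair l5) :)
  have l3 := ((rawCons intE).comp (s13.pair l4) :)
  have l2 := ((rawCons intE).comp (s12.pair l3) :)
  have l1 := ((rawCons intE).comp (s11.pair l2) :)
  exact (hD.pair l1 :)

/-- `rowsOf` is computed on codes (`rawGetOr` at the six indices). [cite: AroraBarak2009, §1.3] -/
theorem rowsOfC : CodeFP (pairE natE (rawE intE)) (pairE (pairE intE (pairE intE intE)) (pairE (pairE intE (pairE intE intE)) (pairE intE (pairE intE intE)))) rowsOf := by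
  have hget : ∀ i : ℕ, CodeFP (pairE natE (rawE intE)) intE (fun c => c.2.getD i 0) := fun i => by
    exact ((rawGetOr intE).comp ((snd _ _).pair ((const _ i).pair (const _ (0 : ℤ)))) :)
  have hz : CodeFP (pairE natE (rawE intE)) intE (fun _ => (0 : ℤ)) := const _ 0
  exact (((hget 0).pair ((hget 1).pair (hget 2))).pair ((hz.pair ((hget 3).pair (hget 4))).pair
    (hz.pair (hz.pair (hget 5)))) :)

/-- `rowOfE` is computed on codes. [folklore] -/
theorem rowOfEC : CodeFP (pairE intE (pairE intE (pairE intE natE))) (pairE intE (pairE intE intE)) rowOfE := by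
  have h1 : CodeFP (pairE intE (pairE intE (pairE intE natE))) intE (fun e => e.1) := fst _ _
  have h2 : CodeFP (pairE intE (pairE intE (pairE intE natE))) intE (fun e => e.2.1) := (snd _ _).fst'
  have h3 : CodeFP (pairE intE (pairE intE (pairE intE natE))) intE (fun e => e.2.2.1) := (snd _ _).snd'.fst'
  exact (h1.pair (h2.pair h3) :)

/-- The context `(a, b)` as a pair of integers. [folklore] -/
theorem abZC : CodeFP (pairE natE natE) (pairE intE intE) (fun p => ((p.1 : ℤ), (p.2 : ℤ))) := by
  exact ((intOfNat.comp (fst _ _)).pair (intOfNat.comp (snd _ _)) :)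

/-- `mulRow` is computed on codes. [cite: AroraBarak2009, §1.3] -/
theorem mulRowC : CodeFP (pairE (pairE intE intE) (pairE (pairE intE (pairE intE intE)) (pairE intE (pairE intE intE)))) (pairE intE (pairE intE intE)) (fun p => mulRow p.1.1 p.1.2 p.2.1 p.2.2) := by
  have ha : CodeFP (pairE (pairE intE intE) (pairE (pairE intE (pairE intE intE)) (pairE intE (pairE intE intE)))) intE (fun p => p.1.1) := (fst _ _).fst'
  have hb : CodeFP (pairE (pairE intE intE) (pairE (pairE intE (pairE intE intE)) (pairE intE (pairE intE intE)))) intE (fun p => p.1.2) := (fst _ _).snd'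
  have s1 : CodeFP (pairE (pairE intE intE) (pairE (pairE intE (pairE intE intE)) (pairE intE (pairE intE intE)))) intE (fun p => p.2.1.1) := (snd _ _).fst'.fst'
  have s2 : CodeFP (pairE (pairE intE intE) (pairE (pairE intE (pairE intE intE)) (pairE intE (pairE intE intE)))) intE (fun p => p.2.1.2.1) := (snd _ _).fst'.snd'.fst'
  have s3 : CodeFP (pairE (pairE intE intE) (pairE (pairE intE (pairE intE intE)) (pairE intE (pairE intE intE)))) intE (fun p => p.2.1.2.2) := (snd _ _).fst'.snd'.snd'
  have t1 : CodeFP (pairE (pairE intE intE) (pairE (pairE intE (pairE intE intE)) (pairE intE (pairE intE intE)))) intE (fun p => p.2.2.1) := (snd _ _).snd'.fst'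
  have t2 : CodeFP (pairE (pairE intE intE) (pairE (pairE intE (pairE intE intE)) (pairE intE (pairE intE intE)))) intE (fun p => p.2.2.2.1) := (snd _ _).snd'.snd'.fst'
  have t3 : CodeFP (pairE (pairE intE intE) (pairE (pairE intE (pairE intE intE)) (pairE intE (pairE intE intE)))) intE (fun p => p.2.2.2.2) := (snd _ _).snd'.snd'.snd'
  have m := fun {f g : (ℤ × ℤ) × Row × Row → ℤ} (hf : CodeFP (pairE (pairE intE intE) (pairE (pairE intE (pairE intE intE)) (pairE intE (pairE intE intE)))) intE f)
    (hg : CodeFP (pairE (pairE intE intE) (pairE (pairE intE (pairE intE intE)) (pairE intE (pairE intE intE)))) intE g) => (intMul.comp (hf.pair hg) :)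
  have ad := fun {f g : (ℤ × ℤ) × Row × Row → ℤ} (hf : CodeFP (pairE (pairE intE intE) (pairE (pairE intE (pairE intE intE)) (pairE intE (pairE intE intE)))) intE f)
    (hg : CodeFP (pairE (pairE intE intE) (pairE (pairE intE (pairE intE intE)) (pairE intE (pairE intE intE)))) intE g) => (intAdd.comp (hf.pair hg) :)
  have c1 : CodeFP (pairE (pairE intE intE) (pairE (pairE intE (pairE intE intE)) (pairE intE (pairE intE intE)))) intE
      (fun p => p.2.1.1 * p.2.2.1 + p.1.1 * p.1.2 * (p.2.1.2.1 * p.2.2.2.2 + p.2.1.2.2 * p.2.2.2.1)) := by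
    exact (ad (m s1 t1) (m (m ha hb) (ad (m s2 t3) (m s3 t2))) :)
  have c2 : CodeFP (pairE (pairE intE intE) (pairE (pairE intE (pairE intE intE)) (pairE intE (pairE intE intE)))) intE
      (fun p => p.2.1.1 * p.2.2.2.1 + p.2.1.2.1 * p.2.2.1 + p.1.1 * (p.2.1.2.2 * p.2.2.2.2)) := by
    exact (ad (ad (m s1 t2) (m s2 t1)) (m ha (m s3 t3)) :)
  have c3 : CodeFP (pairE (pairE intE intE) (pairE (pairE intE (pairE intE intE)) (pairE intE (pairE intE intE)))) intE
      (fun p => p.2.1.1 * p.2.2.2.2 + p.2.1.2.2 * p.2.2.1 + p.1.2 * (p.2.1.2.1 * p.2.2.2.1)) := by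
    exact (ad (ad (m s1 t3) (m s3 t1)) (m hb (m s2 t2)) :)
  exact (c1.pair (c2.pair c3) :)

/-- `normRow` is computed on codes. [cite: AroraBarak2009, §1.3] -/
theorem normRowC : CodeFP (pairE (pairE intE intE) (pairE intE (pairE intE intE))) intE (fun p => normRow p.1.1 p.1.2 p.2) := by
  have ha : CodeFP (pairE (pairE intE intE) (pairE intE (pairE intE intE))) intE (fun p => p.1.1) := (fst _ _).fst'
  have hb : CodeFP (pairE (pairE intE intE) (pairE intE (pairE intE intE))) intE (fun p => p.1.2) := (fst _ _).snd'
  have t1 : CodeFP (pairE (pairE intE intE) (pairE intE (pairE intE intE))) intE (fun p => p.2.1) := (snd _ _).fst'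
  have t2 : CodeFP (pairE (pairE intE intE) (pairE intE (pairE intE intE))) intE (fun p => p.2.2.1) := (snd _ _).snd'.fst'
  have t3 : CodeFP (pairE (pairE intE intE) (pairE intE (pairE intE intE))) intE (fun p => p.2.2.2) := (snd _ _).snd'.snd'
  have m := fun {f g : (ℤ × ℤ) × Row → ℤ} (hf : CodeFP (pairE (pairE intE intE) (pairE intE (pairE intE intE))) intE f)
    (hg : CodeFP (pairE (pairE intE intE) (pairE intE (pairE intE intE))) intE g) => (intMul.comp (hf.pair hg) :)
  have ad := fun {f g : (ℤ × ℤ) × Row → ℤ} (hf : CodeFP (pairE (pairE intE intE) (pairE intE (pairE intE intE))) intE f)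
    (hg : CodeFP (pairE (pairE intE intE) (pairE intE (pairE intE intE))) intE g) => (intAdd.comp (hf.pair hg) :)
  have h3 : CodeFP (pairE (pairE intE intE) (pairE intE (pairE intE intE))) intE (fun _ => (3 : ℤ)) := const _ 3
  have h : CodeFP (pairE (pairE intE intE) (pairE intE (pairE intE intE))) intE (fun p => p.2.1 * p.2.1 * p.2.1 +
      p.1.1 * p.1.2 * p.1.2 * (p.2.2.1 * p.2.2.1 * p.2.2.1) + p.1.1 * p.1.1 * p.1.2 * (p.2.2.2 * p.2.2.2 * p.2.2.2) -
      3 * (p.1.1 * p.1.2) * p.2.1 * p.2.2.1 * p.2.2.2) := by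
    exact (intSub.comp ((ad (ad (m (m t1 t1) t1) (m (m (m ha hb) hb) (m (m t2 t2) t2)))
      (m (m (m ha ha) hb) (m (m t3 t3) t3))).pair (m (m (m (m h3 (m ha hb)) t1) t2) t3)) :)
  exact h.congr fun p => by simp only [normRow]; ring

/-- `scaleRow` is computed on codes. [folklore] -/
theorem scaleRowC : CodeFP (pairE intE (pairE intE (pairE intE intE))) (pairE intE (pairE intE intE)) (fun p => scaleRow p.1 p.2) := by
  have hk : CodeFP (pairE intE (pairE intE (pairE intE intE))) intE (fun p => p.1) := fst _ _
  have h1 : CodeFP (pairE intE (pairE intE (pairE intE intE))) intE (fun p => p.2.1) := (snd _ _).fst'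
  have h2 : CodeFP (pairE intE (pairE intE (pairE intE intE))) intE (fun p => p.2.2.1) := (snd _ _).snd'.fst'
  have h3 : CodeFP (pairE intE (pairE intE (pairE intE intE))) intE (fun p => p.2.2.2) := (snd _ _).snd'.snd'
  exact ((intMul.comp (hk.pair h1)).pair ((intMul.comp (hk.pair h2)).pair (intMul.comp (hk.pair h3))) :)

/-! ### The five programs -/

/-- **`mulE` is typed polynomial time.** [cite: AroraBarak2009, §1.3] -/
theorem mulEC : CodeFP (pairE (pairE natE natE) (pairE (pairE intE (pairE intE (pairE intE natE))) (pairE intE (pairE intE (pairE intE natE))))) (pairE intE (pairE intE (pairE intE natE))) mulE := by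
  have hab : CodeFP (pairE (pairE natE natE) (pairE (pairE intE (pairE intE (pairE intE natE))) (pairE intE (pairE intE (pairE intE natE))))) (pairE intE intE) (fun p => ((p.1.1 : ℤ), (p.1.2 : ℤ))) := by
    exact (abZC.comp (fst _ _) :)
  have r1 : CodeFP (pairE (pairE natE natE) (pairE (pairE intE (pairE intE (pairE intE natE))) (pairE intE (pairE intE (pairE intE natE))))) (pairE intE (pairE intE intE)) (fun p => rowOfE p.2.1) := by
    exact (rowOfEC.comp (snd _ _).fst' :)
  have r2 : CodeFP (pairE (pairE natE natE) (pairE (pairE intE (pairE intE (pairE intE natE))) (pairE intE (pairE intE (pairE intE natE))))) (pairE intE (pairE intE intE)) (fun p => rowOfE p.2.2) := by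
    exact (rowOfEC.comp (snd _ _).snd' :)
  have hr : CodeFP (pairE (pairE natE natE) (pairE (pairE intE (pairE intE (pairE intE natE))) (pairE intE (pairE intE (pairE intE natE))))) (pairE intE (pairE intE intE))
      (fun p => mulRow p.1.1 p.1.2 (rowOfE p.2.1) (rowOfE p.2.2)) := by
    exact (mulRowC.comp (hab.pair (r1.pair r2)) :)
  have hd : CodeFP (pairE (pairE natE natE) (pairE (pairE intE (pairE intE (pairE intE natE))) (pairE intE (pairE intE (pairE intE natE))))) natE (fun p => p.2.1.2.2.2 * p.2.2.2.2.2) := by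
    exact (natMul.comp ((snd _ _).fst'.snd'.snd'.snd'.pair (snd _ _).snd'.snd'.snd'.snd') :)
  exact (hr.fst'.pair (hr.snd'.fst'.pair (hr.snd'.snd'.pair hd)) :)

/-- **`normE` is typed polynomial time.** [cite: AroraBarak2009, §1.3] -/
theorem normEC : CodeFP (pairE (pairE natE natE) (pairE intE (pairE intE (pairE intE natE)))) (pairE intE natE) normE := by
  have hab : CodeFP (pairE (pairE natE natE) (pairE intE (pairE intE (pairE intE natE)))) (pairE intE intE) (fun p => ((p.1.1 : ℤ), (p.1.2 : ℤ))) := by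
    exact (abZC.comp (fst _ _) :)
  have hr : CodeFP (pairE (pairE natE natE) (pairE intE (pairE intE (pairE intE natE)))) (pairE intE (pairE intE intE)) (fun p => rowOfE p.2) := by exact (rowOfEC.comp (snd _ _) :)
  have hn : CodeFP (pairE (pairE natE natE) (pairE intE (pairE intE (pairE intE natE)))) intE (fun p => normRow p.1.1 p.1.2 (rowOfE p.2)) := by
    exact (normRowC.comp (hab.pair hr) :)
  have hd : CodeFP (pairE (pairE natE natE) (pairE intE (pairE intE (pairE intE natE)))) natE (fun p => p.2.2.2.2) := (snd _ _).snd'.snd'.snd'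
  have hd3' : CodeFP (pairE (pairE natE natE) (pairE intE (pairE intE (pairE intE natE)))) natE (fun p => p.2.2.2.2 * p.2.2.2.2 * p.2.2.2.2) := by
    exact (natMul.comp ((natMul.comp (hd.pair hd)).pair hd) :)
  have hd3 : CodeFP (pairE (pairE natE natE) (pairE intE (pairE intE (pairE intE natE)))) natE (fun p => p.2.2.2.2 ^ 3) := hd3'.congr fun p => by ring
  exact (hn.pair hd3 :)

/-- **`latScale` is typed polynomial time.** [cite: AroraBarak2009, §1.3] -/
theorem latScaleC : CodeFP (pairE (pairE natE natE) (pairE (pairE natE (rawE intE)) (pairE intE (pairE intE (pairE intE natE))))) (pairE natE (rawE intE)) latScale := by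
  have hab : CodeFP (pairE (pairE natE natE) (pairE (pairE natE (rawE intE)) (pairE intE (pairE intE (pairE intE natE))))) (pairE intE intE) (fun p => ((p.1.1 : ℤ), (p.1.2 : ℤ))) := by
    exact (abZC.comp (fst _ _) :)
  have hR : CodeFP (pairE (pairE natE natE) (pairE (pairE natE (rawE intE)) (pairE intE (pairE intE (pairE intE natE))))) (pairE (pairE intE (pairE intE intE)) (pairE (pairE intE (pairE intE intE)) (pairE intE (pairE intE intE)))) (fun p => rowsOf p.2.1) := by
    exact (rowsOfC.comp (snd _ _).fst' :)
  have ht : CodeFP (pairE (pairE natE natE) (pairE (pairE natE (rawE intE)) (pairE intE (pairE intE (pairE intE natE))))) (pairE intE (pairE intE intE)) (fun p => rowOfE p.2.2) := by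
    exact (rowOfEC.comp (snd _ _).snd' :)
  have hD : CodeFP (pairE (pairE natE natE) (pairE (pairE natE (rawE intE)) (pairE intE (pairE intE (pairE intE natE))))) natE (fun p => p.2.1.1 * p.2.2.2.2.2) := by
    exact (natMul.comp ((snd _ _).fst'.fst'.pair (snd _ _).snd'.snd'.snd'.snd') :)
  have g1 : CodeFP (pairE (pairE natE natE) (pairE (pairE natE (rawE intE)) (pairE intE (pairE intE (pairE intE natE))))) (pairE intE (pairE intE intE))
      (fun p => mulRow p.1.1 p.1.2 (rowsOf p.2.1).1 (rowOfE p.2.2)) := by exact (mulRowC.comp (hab.pair (hR.fst'.pair ht)) :)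
  have g2 : CodeFP (pairE (pairE natE natE) (pairE (pairE natE (rawE intE)) (pairE intE (pairE intE (pairE intE natE))))) (pairE intE (pairE intE intE))
      (fun p => mulRow p.1.1 p.1.2 (rowsOf p.2.1).2.1 (rowOfE p.2.2)) := by
    exact (mulRowC.comp (hab.pair (hR.snd'.fst'.pair ht)) :)
  have g3 : CodeFP (pairE (pairE natE natE) (pairE (pairE natE (rawE intE)) (pairE intE (pairE intE (pairE intE natE))))) (pairE intE (pairE intE intE))
      (fun p => mulRow p.1.1 p.1.2 (rowsOf p.2.1).2.2 (rowOfE p.2.2)) := by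
    exact (mulRowC.comp (hab.pair (hR.snd'.snd'.pair ht)) :)
  have hh := hnfListC (eσ := pairE (pairE natE natE) (pairE (pairE natE (rawE intE)) (pairE intE (pairE intE (pairE intE natE))))) [_, _, _] (by
    intro f hf
    simp only [List.mem_cons, List.not_mem_nil, or_false] at hf
    rcases hf with rfl | rfl | rfl
    exacts [g1, g2, g3])
  exact (codeOfC.comp (hD.pair hh) :)

/-- **`latProd` is typed polynomial time.** [cite: AroraBarak2009, §1.3] -/
theorem latProdC : CodeFP (pairE (pairE natE natE) (pairE (pairE natE (rawE intE)) (pairE natE (rawE intE)))) (pairE natE (rawE intE)) latProd := by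
  have hab : CodeFP (pairE (pairE natE natE) (pairE (pairE natE (rawE intE)) (pairE natE (rawE intE)))) (pairE intE intE) (fun p => ((p.1.1 : ℤ), (p.1.2 : ℤ))) := by
    exact (abZC.comp (fst _ _) :)
  have hR : CodeFP (pairE (pairE natE natE) (pairE (pairE natE (rawE intE)) (pairE natE (rawE intE)))) (pairE (pairE intE (pairE intE intE)) (pairE (pairE intE (pairE intE intE)) (pairE intE (pairE intE intE)))) (fun p => rowsOf p.2.1) := by
    exact (rowsOfC.comp (snd _ _).fst' :)
  have hS : CodeFP (pairE (pairE natE natE) (pairE (pairE natE (rawE intE)) (pairE natE (rawE intE)))) (pairE (pairE intE (pairE intE intE)) (pairE (pairE intE (pairE intE intE)) (pairE intE (pairE intE intE)))) (fun p => rowsOf p.2.2) := by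
    exact (rowsOfC.comp (snd _ _).snd' :)
  have hD : CodeFP (pairE (pairE natE natE) (pairE (pairE natE (rawE intE)) (pairE natE (rawE intE)))) natE (fun p => p.2.1.1 * p.2.2.1) := by
    exact (natMul.comp ((snd _ _).fst'.fst'.pair (snd _ _).snd'.fst') :)
  have g := fun {f g : (ℕ × ℕ) × (ℕ × List ℤ) × (ℕ × List ℤ) → Row}
    (hf : CodeFP (pairE (pairE natE natE) (pairE (pairE natE (rawE intE)) (pairE natE (rawE intE)))) (pairE intE (pairE intE intE)) f)
    (hg : CodeFP (pairE (pairE natE natE) (pairE (pairE natE (rawE intE)) (pairE natE (rawE intE)))) (pairE intE (pairE intE intE)) g) => (mulRowC.comp (hab.pair (hf.pair hg)) :)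
  have hh := hnfListC (eσ := pairE (pairE natE natE) (pairE (pairE natE (rawE intE)) (pairE natE (rawE intE)))) [_, _, _, _, _, _, _, _, _] (by
    intro f hf
    simp only [List.mem_cons, List.not_mem_nil, or_false] at hf
    rcases hf with rfl | rfl | rfl | rfl | rfl | rfl | rfl | rfl | rfl
    exacts [g hR.fst' hS.fst', g hR.fst' hS.snd'.fst', g hR.fst' hS.snd'.snd', g hR.snd'.fst' hS.fst',
      g hR.snd'.fst' hS.snd'.fst', g hR.snd'.fst' hS.snd'.snd', g hR.snd'.snd' hS.fst', g hR.snd'.snd' hS.snd'.fst',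
      g hR.snd'.snd' hS.snd'.snd'])
  exact (codeOfC.comp (hD.pair hh) :)

/-- **`latAddGen` is typed polynomial time.** [cite: AroraBarak2009, §1.3] -/
theorem latAddGenC : CodeFP (pairE (pairE natE natE) (pairE (pairE natE (rawE intE)) (pairE intE (pairE intE (pairE intE natE))))) (pairE natE (rawE intE)) latAddGen := by
  have hR : CodeFP (pairE (pairE natE natE) (pairE (pairE natE (rawE intE)) (pairE intE (pairE intE (pairE intE natE))))) (pairE (pairE intE (pairE intE intE)) (pairE (pairE intE (pairE intE intE)) (pairE intE (pairE intE intE)))) (fun p => rowsOf p.2.1) := by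
    exact (rowsOfC.comp (snd _ _).fst' :)
  have ht : CodeFP (pairE (pairE natE natE) (pairE (pairE natE (rawE intE)) (pairE intE (pairE intE (pairE intE natE))))) (pairE intE (pairE intE intE)) (fun p => rowOfE p.2.2) := by
    exact (rowOfEC.comp (snd _ _).snd' :)
  have hc1 : CodeFP (pairE (pairE natE natE) (pairE (pairE natE (rawE intE)) (pairE intE (pairE intE (pairE intE natE))))) intE (fun p => (p.2.1.1 : ℤ)) := by
    exact (intOfNat.comp (snd _ _).fst'.fst' :)
  have hde : CodeFP (pairE (pairE natE natE) (pairE (pairE natE (rawE intE)) (pairE intE (pairE intE (pairE intE natE))))) intE (fun p => (p.2.2.2.2.2 : ℤ)) := by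
    exact (intOfNat.comp (snd _ _).snd'.snd'.snd'.snd' :)
  have hD : CodeFP (pairE (pairE natE natE) (pairE (pairE natE (rawE intE)) (pairE intE (pairE intE (pairE intE natE))))) natE (fun p => p.2.1.1 * p.2.2.2.2.2) := by
    exact (natMul.comp ((snd _ _).fst'.fst'.pair (snd _ _).snd'.snd'.snd'.snd') :)
  have g1 : CodeFP (pairE (pairE natE natE) (pairE (pairE natE (rawE intE)) (pairE intE (pairE intE (pairE intE natE))))) (pairE intE (pairE intE intE)) (fun p => scaleRow p.2.2.2.2.2 (rowsOf p.2.1).1) := by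
    exact (scaleRowC.comp (hde.pair hR.fst') :)
  have g2 : CodeFP (pairE (pairE natE natE) (pairE (pairE natE (rawE intE)) (pairE intE (pairE intE (pairE intE natE))))) (pairE intE (pairE intE intE)) (fun p => scaleRow p.2.2.2.2.2 (rowsOf p.2.1).2.1) := by
    exact (scaleRowC.comp (hde.pair hR.snd'.fst') :)
  have g3 : CodeFP (pairE (pairE natE natE) (pairE (pairE natE (rawE intE)) (pairE intE (pairE intE (pairE intE natE))))) (pairE intE (pairE intE intE)) (fun p => scaleRow p.2.2.2.2.2 (rowsOf p.2.1).2.2) := by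
    exact (scaleRowC.comp (hde.pair hR.snd'.snd') :)
  have g4 : CodeFP (pairE (pairE natE natE) (pairE (pairE natE (rawE intE)) (pairE intE (pairE intE (pairE intE natE))))) (pairE intE (pairE intE intE)) (fun p => scaleRow p.2.1.1 (rowOfE p.2.2)) := by
    exact (scaleRowC.comp (hc1.pair ht) :)
  have hh := hnfListC (eσ := pairE (pairE natE natE) (pairE (pairE natE (rawE intE)) (pairE intE (pairE intE (pairE intE natE))))) [_, _, _, _] (by
    intro f hf
    simp only [List.mem_cons, List.not_mem_nil, or_false] at hf
    rcases hf with rfl | rfl | rfl | rfl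
    exacts [g1, g2, g3, g4])
  exact (codeOfC.comp (hD.pair hh) :)

end PureCubicFP

end Literature.Computability.Cryptography
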